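import Literature.Analysis.FluidPDE.PalasekObukhov.TowerEnvelope

/-!
# Palasek 2026, Remark 1.7: the tower is regular before the blow-up time and leaves the critical space at it

S. Palasek, *Finite-time blow-up in an elementary model of the 3D Navier–Stokes equations*,
arXiv:2605.13827 (2026) [Palasek2026ElementaryModel], §1.2 Remark 1.7 with §3.2, p. 10 ((final_bounds),
(exp_small)). PROVED theorems (standard axioms; no definitions, no named facts) about the MODEL tower
`IsTowerSolution ν α N₀ b β c x` of `TowerEnvelope.lean` — an ODE shell model; nothing here is a
statement about Navier–Stokes.

## What the source prints

* §3, first paragraph (p. 8): the physical amplitudes are `X_k = N_k^{-α} x_k` ("Dimensionally, `x`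
  corresponds to (for instance) `‖P_k ω‖_∞`").
* §3.2, p. 10 (proof of Thm 1.8, used verbatim for Thm 1.3): "What remains is to show that
  `X(t) ∈ 𝒞^∞` for `t ∈ [-T,0)`, from which we can infer that a finite-time blow-up indeed occurs at
  `t = 0`. Toward this, fix any `σ > 0` and `t ∈ [-T,0)`, and let `k_* ∈ ℕ` such that `t_{k_*} > t`. …
  By (final_bounds) and (exp_small), we have
  `sup_{k>k_*} N_k^σ|X_k| ≲ sup_{k>k_*} A_k N_k^{σ-α} exp(-(c/2)A_{k-1}/A_{k-2}) < ∞`."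
* Remark 1.7 (p. 4): "Unboundedness in `𝒞^s` for `s > 0` is sharp in light of the fact that `𝒞^0` is
  controlled by the energy … One can see in particular that the blow-up is Type II in the sense that
  it exits the critical space `𝒞^{α-2}`. Indeed, in the notation of §3, the solution approaches the
  blow-up state `X_k = N_k^{β-α}` for some `β > 2`." (`𝒞^{α-2}` is the critical space: Rem. 1.5, "when
  `α ≤ 2`, the energy is critical or better"; §2, the discrete scaling symmetry.)

## What this file proves (all for an ARBITRARY tower solution, not only the tree's `∃`-witness)

* `IsTowerSolution.memWeighted_of_lt_zero` — **regularity before the blow-up time**: for `b > 1`,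
  `β > 0`, every weighted norm `sup_k N_k^σ·|N_k^{-α}x_k(t)|` is finite at every `t ∈ [-T, 0)` (every
  `σ ∈ ℝ`; so `X(t) ∈ 𝒞^∞`, `memSmooth_of_lt_zero`). The printed estimate, with the envelope
  `x_k ≤ 2A_k e^{½A_{k-1}max{t,t_k}}` of (sol_bounds) and `e^{a max{u,v}} ≤ e^{au} + e^{av}`; the two
  resulting double exponentials are bounded by `exists_bound_affine_sub_mul_exp` (the tree's
  (exp_small) engine in `PalasekObukhovBlowupProof.lean`). Until now this step existed in the tree only
  inside the `∃`-witnesses of `Palasek2026_viscousBlowup` / `Palasek2026_inviscidBlowup`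
  (`IsSolutionOn`, third clause), not as a property of every `IsTowerSolution`.
* `IsTowerSolution.critWeight_terminal`, `physAmp_terminal` — **the blow-up state**: at `t = 0`,
  `N_k^{-α}x_k(0) = N_k^{β-α}` and its `𝒞^{α-2}`-weight is `N_k^{α-2}·N_k^{β-α} = N_k^{β-2}`.
* `IsTowerSolution.critWeight_ge` / `critWeight_le` — on the last window `[t_{k+1}, 0]` the
  `𝒞^{α-2}`-weight of mode `k` is pinched between `¾N_k^{β-2}` and `2N_k^{β-2}` (from `¾A_k ≤ x_k ≤ 2A_k`,
  Lemma 3.2 via `host_pump`).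
* `IsTowerSolution.not_memWeighted_critical_terminal`, `critWeight_unbounded`,
  `not_uniform_memWeighted_critical`, `typeII_exit` — **Remark 1.7**: for `b > 1`, `β > 2` the blow-up
  state lies outside `𝒞^{α-2}`, and the critical norm of `X(t)`, finite at every `t < 0`, is unbounded
  as `t ↑ 0` ("exits the critical space" — Type II in the source's sense).
* `IsTowerSolution.neg_tAct_succ_mul_ge`, `typeI_product_unbounded` — the same exit read in the
  self-similar normalisation: `|t_{k+1}|·x_k(t_{k+1}) ≥ ¾c·A_k/A_{k-1} = ¾c·N_{k-1}^{β(b-1)}`, so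
  `sup_k |t|·x_k(t)` (with `x_k ∼ ‖P_kω‖_∞`, a Type-I rate would keep this bounded) is unbounded along
  `t = t_{k+1} ↑ 0` for `b > 1`, `β > 0` (one line from Lemma 3.2 and (tk_times_def); recorded because
  the cell's exclusion-criteria sheet reads the tower's type off this product).
* `exists_isTowerSolution_typeII` — existence of such towers for every large base, i.e.
  `exists_isTowerSolution` with the three conclusions attached (`ν ≥ 0`, `1 < b`, `2b < β < α`).

## Rendering

Physical amplitude `X_k(t) := N_k^{-α}·x_k(t)` is written inline as `scale N₀ b k ^ (-α) * x t k`;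
the weighted spaces are the tree's `MemWeighted` / `MemSmooth` (`PalasekObukhovBlowup.lean`, Def. 1.1);
time runs over the lifespan `[-T, 0]`, `T = horizon N₀ b β c`, blow-up at `t = 0`, as in
`TowerEnvelope.lean`.
-/

open Set Filter Topology

namespace Literature.Analysis.FluidPDE

namespace PalasekObukhov

/-! ### Weights and schedule algebra -/

section Weights

variable {N₀ b β α c : ℝ}

/-- The `𝒞^{α-2}`-weight of a physical amplitude: `N^{α-2}·(N^{-α}y) = N^{-2}y` (`N > 0`). [folklore] -/
private theorem rpow_crit_mul_rpow_neg_mul {N : ℝ} (hN : 0 < N) (α y : ℝ) :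
    N ^ (α - 2) * (N ^ (-α) * y) = N ^ (-2 : ℝ) * y := by
  rw [← mul_assoc, ← Real.rpow_add hN, show α - 2 + -α = (-2 : ℝ) by ring]

/-- A general weight: `N_k^σ·(N_k^{-α}y) = N_k^{σ-α}y`. [folklore] -/
private theorem scale_rpow_mul_rpow_neg_mul (hN₀ : 0 < N₀) (b σ α y : ℝ) (k : ℕ) :
    scale N₀ b k ^ σ * (scale N₀ b k ^ (-α) * y) = scale N₀ b k ^ (σ - α) * y := by
  rw [← mul_assoc, ← Real.rpow_add (scale_pos hN₀ b k), show σ + -α = σ - α by ring]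

/-- `N_k^{-2}·A_k = N_k^{β-2}` (`A_k = N_k^β`). [cite: Palasek2026ElementaryModel, §3.1 ("A_k = N_k^β")] -/
theorem scale_rpow_neg_two_mul_amp (hN₀ : 0 < N₀) (b β : ℝ) (k : ℕ) :
    scale N₀ b k ^ (-2 : ℝ) * amp N₀ b β k = scale N₀ b k ^ (β - 2) := by
  rw [amp, ← Real.rpow_add (scale_pos hN₀ b k), show (-2 : ℝ) + β = β - 2 by ring]

/-- `N_k^{p}·A_k = exp((p+β)·b^k log N₀)`. [cite: Palasek2026ElementaryModel, §1.2 (nk_choice), §3.1] -/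
theorem scale_rpow_mul_amp_eq_exp (hN₀ : 0 < N₀) (b β p : ℝ) (k : ℕ) :
    scale N₀ b k ^ p * amp N₀ b β k = Real.exp ((p + β) * (b ^ k * Real.log N₀)) := by
  rw [amp, ← Real.rpow_add (scale_pos hN₀ b k), scale_eq_exp hN₀, ← Real.exp_mul]
  congr 1
  ring

/-- **`N_k → ∞` along the levels** (`N₀ > 1`, `b > 1`). [cite: Palasek2026ElementaryModel, §1.2 (nk_choice)] -/
theorem tendsto_scale_atTop (hN₀ : 1 < N₀) (hb : 1 < b) :
    Tendsto (fun k : ℕ => scale N₀ b k) atTop atTop := by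
  have hN₀' : 0 < N₀ := lt_trans one_pos hN₀
  have hfun : (fun k : ℕ => scale N₀ b k) = fun k => Real.exp (b ^ k * Real.log N₀) := by
    funext k
    exact scale_eq_exp hN₀' b k
  rw [hfun]
  exact Real.tendsto_exp_atTop.comp (tendsto_log_scale_atTop hN₀ hb)

/-- Positive powers of the scales diverge: `N_k^γ → ∞` for `γ > 0` (`N₀ > 1`, `b > 1`).
[cite: Palasek2026ElementaryModel, §1.2 (nk_choice)] -/
theorem tendsto_scale_rpow_atTop (hN₀ : 1 < N₀) (hb : 1 < b) {γ : ℝ} (hγ : 0 < γ) :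
    Tendsto (fun k : ℕ => scale N₀ b k ^ γ) atTop atTop :=
  (tendsto_rpow_atTop hγ).comp (tendsto_scale_atTop hN₀ hb)

/-- `t_{k+1} = -c/A_{k∸1}` (so `t₁ = t₂ = -c/A₀ = -T`, `t_{k+1} = -c/A_{k-1}` for `k ≥ 1`).
[cite: Palasek2026ElementaryModel, §3.1 (tk_times_def)] -/
theorem tAct_succ (N₀ b β c : ℝ) (k : ℕ) :
    tAct N₀ b β c (k + 1) = -(c / amp N₀ b β (k - 1)) := by
  rw [tAct, show k + 1 - 2 = k - 1 by omega]

/-- `e^{a max{u,v}} ≤ e^{au} + e^{av}`. [folklore] -/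
private theorem exp_mul_max_le_add (a u v : ℝ) :
    Real.exp (a * max u v) ≤ Real.exp (a * u) + Real.exp (a * v) := by
  rcases le_total u v with huv | hvu
  · rw [max_eq_right huv]
    linarith [Real.exp_pos (a * u)]
  · rw [max_eq_left hvu]
    linarith [Real.exp_pos (a * v)]

end Weights

namespace IsTowerSolution

variable {ν α N₀ b β c : ℝ} {x : ℝ → ℕ → ℝ} (h : IsTowerSolution ν α N₀ b β c x)
include h

/-! ### The blow-up state and the critical weight along the tower -/

/-- `t_k < 0`: every activation time is strictly before the blow-up time (`c > 0`).
[cite: Palasek2026ElementaryModel, §3.1 (tk_times_def)] -/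
theorem tAct_lt_zero (k : ℕ) : tAct N₀ b β c k < 0 := by
  rw [tAct, neg_lt_zero]
  exact div_pos h.c_pos (h.amp_pos _)

/-- The physical amplitudes `X_k(t) = N_k^{-α}x_k(t)` are nonnegative on `[-T, 0]`.
[cite: Palasek2026ElementaryModel, §3 ("X_k = N_k^{-α} x_k"), §3.3 (sol_bounds)] -/
theorem physAmp_nonneg (k : ℕ) {t : ℝ} (ht : t ∈ Icc (-horizon N₀ b β c) 0) :
    0 ≤ scale N₀ b k ^ (-α) * x t k :=
  mul_nonneg (Real.rpow_pos_of_pos (scale_pos h.N₀_pos b k) _).le (h.pos k ht).le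

/-- **The blow-up state** (Rem. 1.7: "the solution approaches the blow-up state `X_k = N_k^{β-α}`"):
at `t = 0`, `N_k^{-α}x_k(0) = N_k^{β-α}`. [cite: Palasek2026ElementaryModel, §1.2 Rem. 1.7; §3.2 ("x_k(0) = A_k")] -/
theorem physAmp_terminal (k : ℕ) :
    scale N₀ b k ^ (-α) * x 0 k = scale N₀ b k ^ (β - α) := by
  rw [h.terminal k, amp, ← Real.rpow_add (scale_pos h.N₀_pos b k), show -α + β = β - α by ring]

/-- The `𝒞^{α-2}`-weight of the blow-up state: `N_k^{α-2}·N_k^{-α}x_k(0) = N_k^{β-2}`.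
[cite: Palasek2026ElementaryModel, §1.2 Rem. 1.7] -/
theorem critWeight_terminal (k : ℕ) :
    scale N₀ b k ^ (α - 2) * (scale N₀ b k ^ (-α) * x 0 k) = scale N₀ b k ^ (β - 2) := by
  rw [rpow_crit_mul_rpow_neg_mul (scale_pos h.N₀_pos b k), h.terminal k,
    scale_rpow_neg_two_mul_amp h.N₀_pos]

/-- **Lower pinch on the last window**: for `t ∈ [t_{k+1}, 0]` the `𝒞^{α-2}`-weight of mode `k` is at
least `¾N_k^{β-2}` (from `x_k ≥ ¾A_k`, Lemma 3.2 (eta_quarter_bound)).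
[cite: Palasek2026ElementaryModel, §3.1 Lemma 3.2 (eta_quarter_bound); §1.2 Rem. 1.7] -/
theorem critWeight_ge (k : ℕ) {t : ℝ} (ht : t ∈ Icc (tAct N₀ b β c (k + 1)) 0) :
    3 / 4 * scale N₀ b k ^ (β - 2) ≤ scale N₀ b k ^ (α - 2) * (scale N₀ b k ^ (-α) * x t k) := by
  rw [rpow_crit_mul_rpow_neg_mul (scale_pos h.N₀_pos b k),
    ← scale_rpow_neg_two_mul_amp h.N₀_pos b β k]
  have hw : 0 ≤ scale N₀ b k ^ (-2 : ℝ) := (Real.rpow_pos_of_pos (scale_pos h.N₀_pos b k) _).le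
  have hq := (h.host_pump k ht).1
  calc 3 / 4 * (scale N₀ b k ^ (-2 : ℝ) * amp N₀ b β k)
      = scale N₀ b k ^ (-2 : ℝ) * (3 / 4 * amp N₀ b β k) := by ring
    _ ≤ scale N₀ b k ^ (-2 : ℝ) * x t k := mul_le_mul_of_nonneg_left hq hw

/-- **Upper pinch everywhere**: on `[-T, 0]` the `𝒞^{α-2}`-weight of mode `k` is at most `2N_k^{β-2}`
(from the ceiling `x_k ≤ 2A_k` of (sol_bounds)). [cite: Palasek2026ElementaryModel, §3.3 (sol_bounds); §1.2 Rem. 1.7] -/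
theorem critWeight_le (k : ℕ) {t : ℝ} (ht : t ∈ Icc (-horizon N₀ b β c) 0) :
    scale N₀ b k ^ (α - 2) * (scale N₀ b k ^ (-α) * x t k) ≤ 2 * scale N₀ b k ^ (β - 2) := by
  rw [rpow_crit_mul_rpow_neg_mul (scale_pos h.N₀_pos b k),
    ← scale_rpow_neg_two_mul_amp h.N₀_pos b β k]
  have hw : 0 ≤ scale N₀ b k ^ (-2 : ℝ) := (Real.rpow_pos_of_pos (scale_pos h.N₀_pos b k) _).le
  have hq := h.le_two_mul_amp k ht
  calc scale N₀ b k ^ (-2 : ℝ) * x t k ≤ scale N₀ b k ^ (-2 : ℝ) * (2 * amp N₀ b β k) :=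
        mul_le_mul_of_nonneg_left hq hw
    _ = 2 * (scale N₀ b k ^ (-2 : ℝ) * amp N₀ b β k) := by ring

/-! ### Remark 1.7: the blow-up exits the critical space `𝒞^{α-2}` (Type II) -/

/-- **The blow-up state is outside the critical space** (Rem. 1.7): for `b > 1` and `β > 2`,
`sup_k N_k^{α-2}·|N_k^{-α}x_k(0)| = sup_k N_k^{β-2} = ∞`, i.e. `X(0) ∉ 𝒞^{α-2}`.
[cite: Palasek2026ElementaryModel, §1.2 Rem. 1.7] -/
theorem not_memWeighted_critical_terminal (hb : 1 < b) (hβ : 2 < β) :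
    ¬ MemWeighted (scale N₀ b) (α - 2) (fun k => scale N₀ b k ^ (-α) * x 0 k) := by
  rintro ⟨C, hC⟩
  have ht := tendsto_scale_rpow_atTop h.one_lt_N₀ hb (show 0 < β - 2 by linarith)
  obtain ⟨k, hk⟩ := (ht.eventually_gt_atTop C).exists
  have hCk : scale N₀ b k ^ (α - 2) * |scale N₀ b k ^ (-α) * x 0 k| ≤ C := hC k
  rw [abs_of_nonneg (h.physAmp_nonneg k h.zero_mem_Icc), h.critWeight_terminal k] at hCk
  exact (lt_irrefl C) (hk.trans_le hCk)

/-- **The critical norm is unbounded as `t ↑ 0`** (Rem. 1.7, dynamic form): for `b > 1`, `β > 2` and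
every `M` there is a level `k` whose `𝒞^{α-2}`-weight exceeds `M` throughout the last window
`[t_{k+1}, 0]`. [cite: Palasek2026ElementaryModel, §1.2 Rem. 1.7; §3.1 Lemma 3.2 (eta_quarter_bound)] -/
theorem critWeight_unbounded (hb : 1 < b) (hβ : 2 < β) (M : ℝ) :
    ∃ k : ℕ, ∀ t ∈ Icc (tAct N₀ b β c (k + 1)) 0,
      M < scale N₀ b k ^ (α - 2) * (scale N₀ b k ^ (-α) * x t k) := by
  have ht := tendsto_scale_rpow_atTop h.one_lt_N₀ hb (show 0 < β - 2 by linarith)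
  obtain ⟨k, hk⟩ := (ht.eventually_gt_atTop (4 / 3 * M)).exists
  refine ⟨k, fun t htk => ?_⟩
  have hge := h.critWeight_ge k htk
  linarith

/-- The same with the time exhibited inside the lifespan: for every `M` some `t ∈ [-T, 0)` and some
level `k` have `𝒞^{α-2}`-weight `> M` (take `t = t_{k+1}`). [cite: Palasek2026ElementaryModel, §1.2 Rem. 1.7] -/
theorem critWeight_unbounded_Ico (hb : 1 < b) (hβ : 2 < β) (M : ℝ) :
    ∃ t ∈ Ico (-horizon N₀ b β c) 0, ∃ k : ℕ,
      M < scale N₀ b k ^ (α - 2) * (scale N₀ b k ^ (-α) * x t k) := by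
  obtain ⟨k, hk⟩ := h.critWeight_unbounded hb hβ M
  exact ⟨tAct N₀ b β c (k + 1), ⟨h.neg_horizon_le_tAct _, h.tAct_lt_zero _⟩, k,
    hk _ ⟨le_rfl, h.tAct_le_zero _⟩⟩

/-- Hence no bound on the critical norm is uniform on `[-T, 0)`: `sup_{t<0} ‖X(t)‖_{𝒞^{α-2}} = ∞`
(`b > 1`, `β > 2`). [cite: Palasek2026ElementaryModel, §1.2 Rem. 1.7] -/
theorem not_uniform_memWeighted_critical (hb : 1 < b) (hβ : 2 < β) :
    ¬ ∃ C : ℝ, ∀ t ∈ Ico (-horizon N₀ b β c) 0, ∀ k : ℕ,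
      scale N₀ b k ^ (α - 2) * |scale N₀ b k ^ (-α) * x t k| ≤ C := by
  rintro ⟨C, hC⟩
  obtain ⟨t, ht, k, hk⟩ := h.critWeight_unbounded_Ico hb hβ C
  have hCk := hC t ht k
  rw [abs_of_nonneg (h.physAmp_nonneg k (Ico_subset_Icc_self ht))] at hCk
  exact (lt_irrefl C) (hk.trans_le hCk)

/-! ### Regularity before the blow-up time (§3.2, p. 10) -/

/-- **`X(t) ∈ 𝒞^σ` for every `σ` and every `t ∈ [-T, 0)`** (`b > 1`, `β > 0`): the weighted norm
`sup_k N_k^σ|N_k^{-α}x_k(t)|` is finite. Printed proof: by (sol_bounds),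
`N_k^σ X_k(t) ≤ 2N_k^{σ-α}A_k e^{½A_{k-1}max{t,t_k}} ≤ 2e^{(σ-α+β)b^k log N₀}(e^{-½|t|A_{k-1}} + e^{-(c/2)A_{k-1}/A_{k-2}})`,
and both double exponentials defeat the polynomial prefactor ((exp_small)); modes `0` and `1` are
bounded by hand. [cite: Palasek2026ElementaryModel, §3.2 p. 10 ((final_bounds), (exp_small)); §3.3 proof of Thm 1.3] -/
theorem memWeighted_of_lt_zero (hb : 1 < b) (hβ : 0 < β) (σ : ℝ) {t : ℝ}
    (ht : t ∈ Ico (-horizon N₀ b β c) 0) :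
    MemWeighted (scale N₀ b) σ (fun k => scale N₀ b k ^ (-α) * x t k) := by
  have hN₀ := h.N₀_pos
  have hL : 0 < Real.log N₀ := Real.log_pos h.one_lt_N₀
  have ht' : t ∈ Icc (-horizon N₀ b β c) 0 := Ico_subset_Icc_self ht
  have hd : 0 < -t := neg_pos.2 ht.2
  have hb1 : 1 ≤ b := hb.le
  have hc := h.c_pos
  obtain ⟨B₁, hB₁⟩ := exists_bound_affine_sub_mul_exp ((σ - α + β) * b) 0
    (show 0 < -t / 2 by linarith) hβ
  obtain ⟨B₂, hB₂⟩ := exists_bound_affine_sub_mul_exp ((σ - α + β) * b ^ 2) 0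
    (show 0 < c / 2 by linarith) (show 0 < β * (b - 1) by nlinarith)
  refine ⟨scale N₀ b 0 ^ (σ - α) * (2 * amp N₀ b β 0) + 2 * Real.exp B₁ + 2 * Real.exp B₂ +
      2 * Real.exp ((σ - α + β) * (b * Real.log N₀) - c / 2), fun k => ?_⟩
  have hy0 : ∀ j : ℕ, 0 ≤ b ^ j * Real.log N₀ := fun j => by positivity
  have hS0 : 0 ≤ scale N₀ b 0 ^ (σ - α) * (2 * amp N₀ b β 0) :=
    mul_nonneg (Real.rpow_pos_of_pos (scale_pos hN₀ b 0) _).le (by linarith [h.amp_pos 0])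
  have hE1 := Real.exp_pos B₁
  have hE2 := Real.exp_pos B₂
  have hE3 := Real.exp_pos ((σ - α + β) * (b * Real.log N₀) - c / 2)
  show scale N₀ b k ^ σ * |scale N₀ b k ^ (-α) * x t k| ≤ _
  rw [abs_of_nonneg (h.physAmp_nonneg k ht'), scale_rpow_mul_rpow_neg_mul hN₀]
  have hw : 0 ≤ scale N₀ b k ^ (σ - α) := (Real.rpow_pos_of_pos (scale_pos hN₀ b k) _).le
  rcases Nat.eq_zero_or_pos k with rfl | hk
  · -- mode `0`: `x₀ ≤ 2A₀`
    have h0 := mul_le_mul_of_nonneg_left (h.le_two_mul_amp 0 ht') hw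
    linarith
  · -- modes `k ≥ 1`: the envelope (sol_bounds)
    have hsb := mul_le_mul_of_nonneg_left (h.sol_bounds k hk t ht').2 hw
    have hpre : scale N₀ b k ^ (σ - α) * (2 * amp N₀ b β k) =
        2 * Real.exp ((σ - α + β) * (b ^ k * Real.log N₀)) := by
      rw [mul_left_comm, scale_rpow_mul_amp_eq_exp hN₀]
    have hpre0 : 0 ≤ 2 * Real.exp ((σ - α + β) * (b ^ k * Real.log N₀)) := by positivity
    have hmax := exp_mul_max_le_add (amp N₀ b β (k - 1) / 2) t (tAct N₀ b β c k)
    have hbk : b ^ k = b ^ (k - 1) * b := by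
      rw [← pow_succ]
      congr 1
      omega
    -- Term 1: `2 e^{(σ-α+β) b^k log N₀} e^{-½|t| A_{k-1}} ≤ 2 e^{B₁}`
    have hT1 : 2 * Real.exp ((σ - α + β) * (b ^ k * Real.log N₀)) *
        Real.exp (amp N₀ b β (k - 1) / 2 * t) ≤ 2 * Real.exp B₁ := by
      have h1 := hB₁ (b ^ (k - 1) * Real.log N₀) (hy0 _)
      rw [mul_assoc, ← Real.exp_add]
      refine mul_le_mul_of_nonneg_left (Real.exp_le_exp.2 (le_trans (le_of_eq ?_) h1)) (by norm_num)
      rw [amp_eq_exp hN₀ b β (k - 1),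
        show β * b ^ (k - 1) * Real.log N₀ = β * (b ^ (k - 1) * Real.log N₀) by ring, hbk]
      ring
    -- Term 2: `2 e^{(σ-α+β) b^k log N₀} e^{½A_{k-1} t_k}`, `½A_{k-1}t_k = -(c/2)A_{k-1}/A_{k-2}`
    have htk : amp N₀ b β (k - 1) / 2 * tAct N₀ b β c k =
        -(c / 2 * (amp N₀ b β (k - 1) / amp N₀ b β (k - 2))) := amp_div_two_mul_tAct N₀ b β c k
    have hT2 : 2 * Real.exp ((σ - α + β) * (b ^ k * Real.log N₀)) *
        Real.exp (amp N₀ b β (k - 1) / 2 * tAct N₀ b β c k) ≤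
        2 * Real.exp B₂ + 2 * Real.exp ((σ - α + β) * (b * Real.log N₀) - c / 2) := by
      rw [htk, mul_assoc, ← Real.exp_add]
      rcases Nat.lt_or_ge k 2 with hk2 | hk2
      · -- `k = 1`: `A₀/A₀ = 1`
        have hk1 : k = 1 := by omega
        subst hk1
        have h1 : amp N₀ b β (1 - 1) / amp N₀ b β (1 - 2) = 1 := div_self (h.amp_pos 0).ne'
        rw [h1, pow_one, mul_one, ← sub_eq_add_neg]
        linarith
      · have hρ : amp N₀ b β (k - 1) / amp N₀ b β (k - 2) =
            Real.exp (β * (b - 1) * (b ^ (k - 2) * Real.log N₀)) := by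
          have h2 := amp_succ_div hN₀ b β (k - 2)
          rw [show k - 2 + 1 = k - 1 by omega] at h2
          rw [h2]
          congr 1
          ring
        have h2 := hB₂ (b ^ (k - 2) * Real.log N₀) (hy0 _)
        have h3 : Real.exp ((σ - α + β) * (b ^ k * Real.log N₀) +
            -(c / 2 * (amp N₀ b β (k - 1) / amp N₀ b β (k - 2)))) ≤ Real.exp B₂ := by
          refine Real.exp_le_exp.2 (le_trans (le_of_eq ?_) h2)
          rw [hρ, show b ^ k = b ^ (k - 2) * b ^ 2 by rw [← pow_add]; congr 1; omega]
          ring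
        linarith
    calc scale N₀ b k ^ (σ - α) * x t k
        ≤ scale N₀ b k ^ (σ - α) * (2 * amp N₀ b β k *
            Real.exp (amp N₀ b β (k - 1) / 2 * max t (tAct N₀ b β c k))) := hsb
      _ = 2 * Real.exp ((σ - α + β) * (b ^ k * Real.log N₀)) *
            Real.exp (amp N₀ b β (k - 1) / 2 * max t (tAct N₀ b β c k)) := by
          rw [← hpre]
          ring
      _ ≤ 2 * Real.exp ((σ - α + β) * (b ^ k * Real.log N₀)) *
            (Real.exp (amp N₀ b β (k - 1) / 2 * t) +
              Real.exp (amp N₀ b β (k - 1) / 2 * tAct N₀ b β c k)) :=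
          mul_le_mul_of_nonneg_left hmax hpre0
      _ = 2 * Real.exp ((σ - α + β) * (b ^ k * Real.log N₀)) *
              Real.exp (amp N₀ b β (k - 1) / 2 * t) +
            2 * Real.exp ((σ - α + β) * (b ^ k * Real.log N₀)) *
              Real.exp (amp N₀ b β (k - 1) / 2 * tAct N₀ b β c k) := by ring
      _ ≤ 2 * Real.exp B₁ +
            (2 * Real.exp B₂ + 2 * Real.exp ((σ - α + β) * (b * Real.log N₀) - c / 2)) :=
          add_le_add hT1 hT2
      _ ≤ _ := by linarith

/-- **`X(t) ∈ 𝒞^∞` before the blow-up time** (`b > 1`, `β > 0`, `t ∈ [-T, 0)`).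
[cite: Palasek2026ElementaryModel, §3.2 p. 10 ("X(t) ∈ 𝒞^∞ for t ∈ [-T,0)")] -/
theorem memSmooth_of_lt_zero (hb : 1 < b) (hβ : 0 < β) {t : ℝ}
    (ht : t ∈ Ico (-horizon N₀ b β c) 0) :
    MemSmooth (scale N₀ b) (fun k => scale N₀ b k ^ (-α) * x t k) :=
  fun σ _ => h.memWeighted_of_lt_zero hb hβ σ ht

/-- **Remark 1.7 assembled — Type II: the tower exits the critical space `𝒞^{α-2}` at the blow-up
time.** For `b > 1`, `β > 2`: (i) `X(t) ∈ 𝒞^σ` for every `σ` and every `t ∈ [-T, 0)` (in particular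
`X(t) ∈ 𝒞^{α-2}`); (ii) the blow-up state `X(0) = (N_k^{β-α})_k` is not in `𝒞^{α-2}`; (iii) the critical
norm `‖X(t)‖_{𝒞^{α-2}}` is unbounded on `[-T, 0)`. [cite: Palasek2026ElementaryModel, §1.2 Rem. 1.7; §3.2 p. 10] -/
theorem typeII_exit (hb : 1 < b) (hβ : 2 < β) :
    (∀ σ : ℝ, ∀ t ∈ Ico (-horizon N₀ b β c) 0,
        MemWeighted (scale N₀ b) σ (fun k => scale N₀ b k ^ (-α) * x t k)) ∧
      ¬ MemWeighted (scale N₀ b) (α - 2) (fun k => scale N₀ b k ^ (-α) * x 0 k) ∧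
      ∀ M : ℝ, ∃ t ∈ Ico (-horizon N₀ b β c) 0, ∃ k : ℕ,
        M < scale N₀ b k ^ (α - 2) * (scale N₀ b k ^ (-α) * x t k) :=
  ⟨fun σ _ ht => h.memWeighted_of_lt_zero hb (by linarith) σ ht,
    h.not_memWeighted_critical_terminal hb hβ, h.critWeight_unbounded_Ico hb hβ⟩

/-! ### The exit in the self-similar normalisation: `|t|·x_k(t)` is unbounded -/

/-- **`|t_{k+1}|·x_k(t_{k+1}) ≥ ¾c·A_k/A_{k∸1}`**: at the opening of the last window the host amplitude
is already `≥ ¾A_k` (Lemma 3.2) while the time to blow-up is `|t_{k+1}| = c/A_{k-1}` ((tk_times_def)).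
With `x_k ∼ ‖P_kω‖_∞` (§3) a self-similar (Type-I) rate would keep `|t|·x_k(t)` bounded.
[cite: Palasek2026ElementaryModel, §3.1 (tk_times_def), Lemma 3.2 (eta_quarter_bound); §3 ("x corresponds to ‖P_k ω‖_∞")] -/
theorem neg_tAct_succ_mul_ge (k : ℕ) :
    3 / 4 * c * (amp N₀ b β k / amp N₀ b β (k - 1)) ≤
      -tAct N₀ b β c (k + 1) * x (tAct N₀ b β c (k + 1)) k := by
  have ht : tAct N₀ b β c (k + 1) ∈ Icc (tAct N₀ b β c (k + 1)) 0 := ⟨le_rfl, h.tAct_le_zero _⟩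
  have hq := (h.host_pump k ht).1
  have hA := h.amp_pos (k - 1)
  have hneg : -tAct N₀ b β c (k + 1) = c / amp N₀ b β (k - 1) := by
    rw [tAct_succ, neg_neg]
  calc 3 / 4 * c * (amp N₀ b β k / amp N₀ b β (k - 1))
      = c / amp N₀ b β (k - 1) * (3 / 4 * amp N₀ b β k) := by ring
    _ ≤ c / amp N₀ b β (k - 1) * x (tAct N₀ b β c (k + 1)) k :=
        mul_le_mul_of_nonneg_left hq (div_pos h.c_pos hA).le
    _ = -tAct N₀ b β c (k + 1) * x (tAct N₀ b β c (k + 1)) k := by rw [hneg]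

/-- **`sup_k |t|·x_k(t)` is unbounded on `[-T, 0)`** (`b > 1`, `β > 0`): along `t = t_{k+2} ↑ 0`,
`|t|·x_{k+1}(t) ≥ ¾c·A_{k+1}/A_k = ¾c·N_k^{β(b-1)} → ∞` ((ratios)). [cite: Palasek2026ElementaryModel, §3.1 (ratios), (tk_times_def), Lemma 3.2] -/
theorem typeI_product_unbounded (hb : 1 < b) (hβ : 0 < β) (M : ℝ) :
    ∃ t ∈ Ico (-horizon N₀ b β c) 0, ∃ k : ℕ, M < -t * x t k := by
  have hc := h.c_pos
  have hγ : 0 < β * (b - 1) := mul_pos hβ (by linarith)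
  have ht := tendsto_scale_rpow_atTop h.one_lt_N₀ hb hγ
  obtain ⟨j, hj⟩ := (ht.eventually_gt_atTop (M / (3 / 4 * c))).exists
  have hM : M < 3 / 4 * c * scale N₀ b j ^ (β * (b - 1)) := by
    rw [mul_comm]
    exact (div_lt_iff₀ (by positivity)).1 hj
  refine ⟨tAct N₀ b β c (j + 1 + 1), ⟨h.neg_horizon_le_tAct _, h.tAct_lt_zero _⟩, j + 1, ?_⟩
  have hmain := h.neg_tAct_succ_mul_ge (j + 1)
  rw [show j + 1 - 1 = j by omega, amp_succ_div_eq_rpow h.N₀_pos] at hmain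
  exact hM.trans_le hmain

end IsTowerSolution

/-! ### Existence of Type-II towers for every large base -/

/-- **Palasek's towers are Type II** (Thm 1.3's construction read with Rem. 1.7): for `ν ≥ 0`,
`1 < b`, `2b < β < α` there is `N_* > 1` such that every base `N₀ ≥ N_*` carries a tower solution
(schedule `c = 1/10`) which is in every `𝒞^σ` before the blow-up time, whose blow-up state is outside
`𝒞^{α-2}`, and whose critical norm is unbounded as `t ↑ 0`.
[cite: Palasek2026ElementaryModel, §1.2 Thm 1.3, Rem. 1.7; §3.3] -/
theorem exists_isTowerSolution_typeII {ν b β α : ℝ} (hν : 0 ≤ ν) (hb : 1 < b) (hβ : 2 * b < β)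
    (hβα : β < α) :
    ∃ Nstar : ℝ, 1 < Nstar ∧ ∀ N₀ : ℝ, Nstar ≤ N₀ → ∃ x : ℝ → ℕ → ℝ,
      IsTowerSolution ν α N₀ b β (1 / 10) x ∧
      (∀ σ : ℝ, ∀ t ∈ Ico (-horizon N₀ b β (1 / 10)) 0,
          MemWeighted (scale N₀ b) σ (fun k => scale N₀ b k ^ (-α) * x t k)) ∧
      ¬ MemWeighted (scale N₀ b) (α - 2) (fun k => scale N₀ b k ^ (-α) * x 0 k) ∧
      ∀ M : ℝ, ∃ t ∈ Ico (-horizon N₀ b β (1 / 10)) 0, ∃ k : ℕ,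
        M < scale N₀ b k ^ (α - 2) * (scale N₀ b k ^ (-α) * x t k) := by
  obtain ⟨Nstar, hN, hall⟩ := exists_isTowerSolution (α := α) hν hb hβ hβα
  refine ⟨Nstar, hN, fun N₀ hN₀ => ?_⟩
  obtain ⟨x, hx⟩ := hall N₀ hN₀
  have hβ2 : 2 < β := by linarith
  exact ⟨x, hx, hx.typeII_exit hb hβ2⟩

end PalasekObukhov

end Literature.Analysis.FluidPDE
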